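import Summits.BirchSwinnertonDyer.BirchSwinnertonDyer.Theorems.PrintX6DescentCertificateRoad
import HarnessLib

/-!
# Print tier P-X6 (cell `bsd-print-x6`, seat p4): ONE-SIDED descent certificates suffice on the leaf
# `ClassX6 ∧ r_an = 0` — `p^m ≤ #Sel^(p^k)(E/ℚ)` + Kato's bound (Wuthrich 2014 Prop. 21) ⟹ `BSD(E,p)`, and the
# descent is then EXACT as a THEOREM, not as an input

Companion of `Theorems/PrintX6DescentCertificateRoad.lean` (p532160: the EXACT-count road
`X6.bsdp_rankZero_of_card_selmerGroup_primePow` and its completeness iff). PARTITION currency (D-0054): leaf A6 =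
X6 ∧ r_an = 0; per pair; NOT a class theorem; BEYOND-PRINT THEOREM: **NO** (Wuthrich 2014 Prop. 21 `hW`, GZK `hGZK`,
modularity `hmod` + one finite certificate line; Silverman X.4.2 bookkeeping).

WHY (the two-engine certificate rule, REF R-0 (5), and the GRH question of exact descents): in a Schaefer–Stoll
`p`-descent the Selmer group is cut out of `A(S,p) ⊆ A^×/A^{×p}` (`A` the étale algebra of `E[p] ∖ 0`); a BASIS of
`A(S,p)` needs the `S`-class group and `S`-units of `A` — under GRH unless certified (`bnfcertify`), the expensive step
of an EXACT descent — whereas a LOWER bound on `#Sel^(p^k)` only needs EXHIBITED elements (everywhere-locally-soluble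
`p^k`-coverings, independent in `A^×/A^{×p^k}` by a non-power check): unconditional and cheap. On a rank-`0` pair
without rational `p`-torsion `Sel^(p^k) ≅ Ш[p^k] ≤ Ш(p)` (Silverman X.4.2, tree
`card_torsionBy_sha_primePow_eq_card_selmerGroup`), and Kato/Wuthrich bound `#Ш(p)` ABOVE by `p^{ord_p #Ш_an}`; so
`p^m ≤ #Sel^(p^k)` with `ord_p #Ш_an ≤ m` already gives `BSD(E,p)` (`X6.bsdp_rankZero_of_pow_le_card_selmerGroup_primePow`),
and then `#Sel^(p^k)(E/ℚ) = p^m` FOLLOWS (`X6.card_selmerGroup_primePow_eq_of_pow_le`): the «exact» flag of the second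
engine is a CONSEQUENCE of print + the exhibited classes. Certificate currency for the desk: a GRH-free ONE-SIDED
descent row is enough on every non-unit A6 cell. The one-sided iff
`X6.bsdp_rankZero_iff_exists_pow_le_card_selmerGroup_primePow` records that nothing weaker than «enough exhibited
classes at some prime-power level» will do, and nothing stronger is needed.

References: Wuthrich, Doc. Math. 19 (2014) Prop. 21 [Wuthrich2014]; Silverman AEC X.4.2 [SilvermanAEC2009];
Schaefer–Stoll, Trans. AMS 356 (2004) [SchaeferStoll2004] (descent via `A(S,p)`); Miller 2011 Def. 1.1 [Miller2011LMS].
-/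

set_option autoImplicit false
set_option linter.dupNamespace false

noncomputable section

open scoped Classical

open WeierstrassCurve Literature.NumberTheory.EllipticCurves
  Literature.NumberTheory.EllipticCurves.Rank1Residual
  Literature.NumberTheory.EllipticCurves.Rank1Residual.Typed
  Literature.NumberTheory.EllipticCurves.Wuthrich2014
  Summit.BirchSwinnertonDyer.Rank1Residual.Supersingular

namespace Summit.BirchSwinnertonDyer.BirchSwinnertonDyer.Theorems.PrintX6

section OneSided

variable (W : WeierstrassCurve ℚ) [W.IsElliptic] (p : ℕ) [hp : Fact p.Prime]

omit [W.IsElliptic] hp in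
/-- `Ш(E/ℚ)[p^k] ≤ Ш(E/ℚ)(p)` (the `p`-primary part), hence `#Ш[p^k] ∣ #Ш(p)` (Lagrange). [folklore] -/
theorem card_torsionBy_sha_primePow_dvd_card_primaryComponent (k : ℕ) :
    Nat.card (AddSubgroup.torsionBy W.sha (p ^ k : ℕ)) ∣
      Nat.card (AddCommGroup.primaryComponent W.sha p) :=
  AddSubgroup.card_dvd_of_le fun _ hx =>
    AddCommGroup.mem_primaryComponent.mpr ⟨k, AddSubgroup.torsionBy.nsmul_iff.mp hx⟩

/-- **The LOWER half from a ONE-SIDED prime-power descent, class-free, Cassels–Tate-free.** At a pair with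
`ord_{s=1} L(E,s) = 0`, `p ∤ #E(ℚ)_tors`, `#Ш(E/ℚ)_an = q`, and `p^m ≤ #Sel^(p^k)(E/ℚ)` (e.g. `m` independent
everywhere-locally-soluble `p^k`-coverings EXHIBITED — no claim of exactness) with `ord_p q ≤ m`:
`MissingLowerBoundAt W p`. Chain: `#Sel^(p^k) = #Ш[p^k]` (`card_torsionBy_sha_primePow_eq_card_selmerGroup`) divides
`#Ш(p) = p^{ord_p #Ш}` (GZK: `Ш` finite), so `#Ш[p^k] = p^j` with `j ≤ ord_p #Ш`, and `p^m ≤ p^j` gives `m ≤ j`.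
[cite: SilvermanAEC2009, Thm X.4.2(a)] [cite: Miller2011LMS, Def. 1.1 (arXiv:1010.2431 p. 3)] -/
theorem missingLowerBoundAt_of_pow_le_card_selmerGroup_primePow
    (hGZK : rank_eq_analyticRank_of_analyticRank_le_one) (hr : W.analyticRank = 0)
    (htors : ¬ p ∣ W.torsionOrder) {k m : ℕ}
    (hle : p ^ m ≤ Nat.card (W.selmerGroup ((p ^ k : ℕ) : ℤ)))
    {q : ℚ} (hq : shaAn W = (q : ℂ)) (hv : padicValRat p q ≤ m) : MissingLowerBoundAt W p := by
  haveI : Finite W.sha := (hGZK W (by omega)).2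
  have hP : Nat.card (AddCommGroup.primaryComponent W.sha p) = p ^ padicValNat p W.shaOrder := by
    rw [card_addPrimaryComponent_eq_pow, Nat.factorization_def _ hp.out]
    rfl
  have hdvd : Nat.card (AddSubgroup.torsionBy W.sha (p ^ k : ℕ)) ∣ p ^ padicValNat p W.shaOrder :=
    hP ▸ card_torsionBy_sha_primePow_dvd_card_primaryComponent W p k
  obtain ⟨j, hjle, hj⟩ := (Nat.dvd_prime_pow hp.out).mp hdvd
  have hmj : m ≤ j := by
    refine (Nat.pow_le_pow_iff_right hp.out.two_le).mp ?_
    rw [← hj, card_torsionBy_sha_primePow_eq_card_selmerGroup W p hGZK hr htors k]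
    exact hle
  refine ⟨q, hq, hv.trans ?_⟩
  exact_mod_cast hmj.trans hjle

variable [W.IsGloballyMinimal]

/-- **Leaf A6 (X6 ∧ r_an = 0), odd `p`: `BSD(E,p)` from the three PUBLISHED facts + a ONE-SIDED certificate
`p^m ≤ #Sel^(p^k)(E/ℚ)` with `ord_p #Ш_an ≤ m`.** As `X6.bsdp_rankZero_of_card_selmerGroup_primePow` (side conditions
discharged from `ClassX6`; binders `hW` = Wuthrich 2014 Prop. 21, `hGZK`, `hmod`; NO Cassels–Tate), with the exact
count weakened to a lower bound: the GRH-sensitive / certification step of an exact descent is NOT needed for the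
closure. Per pair; NOT a class theorem; beyond-print: no. [cite: Wuthrich2014, Prop. 21 (p. 400)]
[cite: SilvermanAEC2009, Thm X.4.2(a)] [cite: Serre1972, §1.11 Prop. 12 and §5.4 Prop. 21 i)]
[cite: Miller2011LMS, §1 and Def. 1.1] -/
theorem X6.bsdp_rankZero_of_pow_le_card_selmerGroup_primePow (hW : sha_dvd_analyticSha)
    (hGZK : rank_eq_analyticRank_of_analyticRank_le_one) (hmod : hasEntireLFunction_rat)
    (hp2 : p ≠ 2) (hX : ClassX6 W p) (hr : W.analyticRank = 0) {k m : ℕ}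
    (hle : p ^ m ≤ Nat.card (W.selmerGroup ((p ^ k : ℕ) : ℤ)))
    {q : ℚ} (hq : shaAn W = (q : ℂ)) (hv : padicValRat p q ≤ m) : BSDp W p :=
  X6.bsdp_of_missingLowerBoundAt_of_analyticRank_eq_zero W p hW hGZK hmod hp2 hX hr
    (PrintX6.missingLowerBoundAt_of_pow_le_card_selmerGroup_primePow W p hGZK hr
      (not_dvd_torsionOrder_of_irr W p (ClassX6.irr W p hp2 hX)) hle hq hv)

/-- **The `k = 1` instance of the one-sided road**: `p^m ≤ #Sel^(p)(E/ℚ)`, `ord_p #Ш_an ≤ m` ⟹ `BSD(E,p)` on the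
leaf (`m = 2`: two independent soluble `p`-coverings at a `#Ш_an = p²` cell — every non-unit A6 cell of record).
[cite: Wuthrich2014, Prop. 21 (p. 400)] [cite: SilvermanAEC2009, Thm X.4.2(a)] [cite: Miller2011LMS, §1 and Def. 1.1] -/
theorem X6.bsdp_rankZero_of_pow_le_card_selmerGroup (hW : sha_dvd_analyticSha)
    (hGZK : rank_eq_analyticRank_of_analyticRank_le_one) (hmod : hasEntireLFunction_rat)
    (hp2 : p ≠ 2) (hX : ClassX6 W p) (hr : W.analyticRank = 0) {m : ℕ}
    (hle : p ^ m ≤ Nat.card (W.selmerGroup (p : ℤ)))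
    {q : ℚ} (hq : shaAn W = (q : ℂ)) (hv : padicValRat p q ≤ m) : BSDp W p :=
  X6.bsdp_rankZero_of_pow_le_card_selmerGroup_primePow W p hW hGZK hmod hp2 hX hr (k := 1)
    (by rw [pow_one]; exact hle) hq hv

/-- **Exactness for free.** On the leaf, a one-sided certificate `p^m ≤ #Sel^(p^k)(E/ℚ)` at a cell with
`ord_p #Ш_an = m` (exactly) forces the descent to be EXACT: `#Sel^(p^k)(E/ℚ) = p^m` — because `BSD(E,p)` (just
proved) pins `#Ш(p) = p^m` and `Sel^(p^k) ≅ Ш[p^k] ≤ Ш(p)`. So the second engine's «exact» flag is a CONSEQUENCE of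
print + the exhibited classes, not an extra input. [cite: Wuthrich2014, Prop. 21 (p. 400)]
[cite: SilvermanAEC2009, Thm X.4.2(a)] [cite: Miller2011LMS, Def. 1.1 (arXiv:1010.2431 p. 3)] -/
theorem X6.card_selmerGroup_primePow_eq_of_pow_le (hW : sha_dvd_analyticSha)
    (hGZK : rank_eq_analyticRank_of_analyticRank_le_one) (hmod : hasEntireLFunction_rat)
    (hp2 : p ≠ 2) (hX : ClassX6 W p) (hr : W.analyticRank = 0) {k m : ℕ}
    (hle : p ^ m ≤ Nat.card (W.selmerGroup ((p ^ k : ℕ) : ℤ)))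
    {q : ℚ} (hq : shaAn W = (q : ℂ)) (hv : padicValRat p q = m) :
    Nat.card (W.selmerGroup ((p ^ k : ℕ) : ℤ)) = p ^ m := by
  obtain ⟨-, hfin, q', hq', hval⟩ :=
    X6.bsdp_rankZero_of_pow_le_card_selmerGroup_primePow W p hW hGZK hmod hp2 hX hr hle hq hv.le
  haveI := hfin
  have hqq : q' = q := by exact_mod_cast hq'.symm.trans hq
  subst hqq
  obtain ⟨n, hn⟩ := exists_card_addPrimaryComponent_eq_pow (A := W.sha) p
  rw [hn, padicValNat.prime_pow, hv] at hval
  have hnm : n = m := by exact_mod_cast hval.symm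
  have hdvd : Nat.card (W.selmerGroup ((p ^ k : ℕ) : ℤ)) ∣ p ^ m := by
    rw [← card_torsionBy_sha_primePow_eq_card_selmerGroup W p hGZK hr
      (not_dvd_torsionOrder_of_irr W p (ClassX6.irr W p hp2 hX)) k, ← hnm, ← hn]
    exact card_torsionBy_sha_primePow_dvd_card_primaryComponent W p k
  exact le_antisymm (Nat.le_of_dvd (pow_pos hp.out.pos m) hdvd) hle

/-- **The one-sided iff.** On the leaf with odd `p`, granted `hW`, `hGZK`, `hmod` and `#Ш_an = q`:
`BSDp W p ↔ ∃ k m, p^m ≤ #Sel^(p^k)(E/ℚ) ∧ ord_p q = m` — «enough exhibited Selmer classes at some prime-power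
level», no exactness, no pairing. [cite: Wuthrich2014, Prop. 21 (p. 400)] [cite: Miller2011LMS, §1 and Def. 1.1] -/
theorem X6.bsdp_rankZero_iff_exists_pow_le_card_selmerGroup_primePow (hW : sha_dvd_analyticSha)
    (hGZK : rank_eq_analyticRank_of_analyticRank_le_one) (hmod : hasEntireLFunction_rat)
    (hp2 : p ≠ 2) (hX : ClassX6 W p) (hr : W.analyticRank = 0) {q : ℚ} (hq : shaAn W = (q : ℂ)) :
    BSDp W p ↔
      ∃ k m : ℕ, p ^ m ≤ Nat.card (W.selmerGroup ((p ^ k : ℕ) : ℤ)) ∧ padicValRat p q = m := by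
  constructor
  · intro hbsd
    obtain ⟨k, m, hcard, hv⟩ :=
      (X6.bsdp_rankZero_iff_exists_card_selmerGroup_primePow W p hW hGZK hmod hp2 hX hr hq).mp hbsd
    exact ⟨k, m, hcard.ge, hv⟩
  · rintro ⟨k, m, hle, hv⟩
    exact X6.bsdp_rankZero_of_pow_le_card_selmerGroup_primePow W p hW hGZK hmod hp2 hX hr hle hq hv.le

end OneSided

end Summit.BirchSwinnertonDyer.BirchSwinnertonDyer.Theorems.PrintX6

end
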